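import Mathlib
import Summits.Ventures.PercRepro2.Defs
import Summits.Ventures.PercRepro2.Independence
import Summits.Ventures.PercRepro2.Harris
import Summits.Ventures.PercRepro2.Graph
import Summits.Ventures.PercRepro2.Exploration
import Summits.Ventures.PercRepro2.Events
import Summits.Ventures.PercRepro2.Induced

/-!
# Components of `G − {s, t}` and the localisation of connections on `{s ↮ t}`
(blind cell PercRepro2, mine-1 g38; proofs/MINE1-PAIRTP2.md §2, Case A — the graph part)

`comp ends s t u` is the component of `u` in `G − {s, t}` (the cluster of `u` in the
configuration `base` in which every edge not touching `s` or `t` is open).  For a configuration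
`ω`, `restrictK ends K ω` keeps only the edges touching `K`.  The localisation lemma
(`conn_iff_conn_restrictK`): on `{s ↮ t}`, `s ↔ u` in `ω` iff `s ↔ u` in the restriction of
`ω` to the edges touching the component of `u` — an open path from `s` to `u` that avoids `t`
cannot leave the component of `u` once it has entered it, and the only other way in is through
`s` itself.  The proof uses the closure lemma `mem_of_conn_of_closed` only (no walk
combinatorics): the cluster of `u` in the restricted configuration, if it misses `s`, is closed
under open adjacency in `ω`.  The decomposition lemma (`conn_st_iff`): `s ↔ t` in `ω` iff
`s ↔ t` in one of the three restrictions — to the edges touching `comp u`, to those touching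
`comp v`, or to the remaining edges — for `v ∉ comp u`.
-/

namespace Summit.Ventures.PercRepro2

namespace Separated

open scoped Classical

variable {V : Type*} {E : Type*}

/-- The configuration with every edge not touching `s` or `t` open and the edges at `s`, `t`
closed: percolation on `G − {s, t}` with everything open. -/
noncomputable def base (ends : E → Sym2 V) (s t : V) : Config E :=
  induced ends ({s, t} : Set V)ᶜ (fun _ => true)

/-- The component of `u` in `G − {s, t}`. -/
noncomputable def comp (ends : E → Sym2 V) (s t u : V) : Set V :=
  cluster ends (base ends s t) u

/-- `ω` restricted to the edges touching `K` (all other edges closed). -/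
noncomputable def restrictK (ends : E → Sym2 V) (K : Set V) (ω : Config E) : Config E :=
  restrict (touches ends K) ω

variable {ends : E → Sym2 V} {s t : V}

/-- `restrictK ≤ ω`. -/
lemma restrictK_le (K : Set V) (ω : Config E) : restrictK ends K ω ≤ ω :=
  restrict_le _ ω

/-- An open edge of `restrictK` is an open edge of `ω` touching `K`. -/
lemma restrictK_eq_true_iff {K : Set V} {ω : Config E} {e : E} :
    restrictK ends K ω e = true ↔ ω e = true ∧ e ∈ touches ends K :=
  restrict_eq_true_iff

/-- `u ∈ comp u`. -/
lemma mem_comp_self (u : V) : u ∈ comp ends s t u :=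
  mem_cluster_self _ _ _

/-- Vertices of a component are not terminals. -/
lemma comp_subset {u : V} (hu : u ∉ ({s, t} : Set V)) : comp ends s t u ⊆ ({s, t} : Set V)ᶜ :=
  fun _ hx => mem_of_conn_induced (U := ({s, t} : Set V)ᶜ) hu hx

/-- The components of `G − {s, t}` are closed under adjacency off the terminals: an edge from
`x ∈ comp u` to `y ∉ {s, t}` puts `y` into `comp u` (for `u` not a terminal). -/
lemma mem_comp_of_adj {u x y : V} (hu : u ∉ ({s, t} : Set V)) (hx : x ∈ comp ends s t u)
    (hy : y ∉ ({s, t} : Set V)) {e : E} (he : ends e = s(x, y)) : y ∈ comp ends s t u := by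
  have hxst : x ∉ ({s, t} : Set V) := comp_subset hu hx
  have hopen : base ends s t e = true := by
    unfold base
    exact induced_eq_true_iff.2 ⟨rfl, x, hxst, y, hy, he⟩
  exact conn_trans hx (conn_of_openAdj ⟨e, hopen, he⟩)

/-- Symmetric form: an edge from `y ∉ {s, t}` to `x ∈ comp u` puts `y` into `comp u`. -/
lemma mem_comp_of_adj' {u x y : V} (hu : u ∉ ({s, t} : Set V)) (hx : x ∈ comp ends s t u)
    (hy : y ∉ ({s, t} : Set V)) {e : E} (he : ends e = s(y, x)) : y ∈ comp ends s t u :=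
  mem_comp_of_adj hu hx hy (by rw [he, Sym2.eq_swap])

/-- Two components are disjoint or equal: if `v ∉ comp u` then `comp u ∩ comp v = ∅`. -/
lemma comp_disjoint {u v : V} (hv : v ∉ comp ends s t u) : Disjoint (comp ends s t u) (comp ends s t v) := by
  rw [Set.disjoint_left]
  intro x hxu hxv
  exact hv (conn_trans hxu (conn_symm hxv))

/-- The cluster of a vertex of `K ∪ {s, t}` in `restrictK K ω` stays inside `K ∪ {s, t}`, for
`K = comp u` with `u` not a terminal. -/
lemma cluster_restrictK_subset {u w : V} (hu : u ∉ ({s, t} : Set V)) (ω : Config E)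
    (hw : w ∈ comp ends s t u ∪ ({s, t} : Set V)) :
    cluster ends (restrictK ends (comp ends s t u) ω) w ⊆ comp ends s t u ∪ ({s, t} : Set V) := by
  intro z hz
  refine mem_of_conn_of_closed (ends := ends) (ω := restrictK ends (comp ends s t u) ω)
    (S := comp ends s t u ∪ ({s, t} : Set V)) ?_ hw hz
  intro x hx y hxy
  obtain ⟨_, e, he, hends⟩ := openGraph_adj.1 hxy
  obtain ⟨-, hte⟩ := restrictK_eq_true_iff.1 he
  by_cases hyst : y ∈ ({s, t} : Set V)
  · exact Or.inr hyst
  · left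
    rcases hx with hxK | hxst
    · exact mem_comp_of_adj hu hxK hyst hends
    · -- `x` a terminal: the edge touches `K` at `y`
      obtain ⟨a, haK, b, hab⟩ := hte
      rw [hends, Sym2.eq_iff] at hab
      rcases hab with ⟨rfl, rfl⟩ | ⟨rfl, rfl⟩
      · exact absurd hxst (comp_subset hu haK)
      · exact haK

/-- Membership in the terminal pair. -/
lemma mem_pair_iff {x : V} : x ∈ ({s, t} : Set V) ↔ x = s ∨ x = t := by simp

/-- **Localisation of connections on `{s ↮ t}`**: if `s ↔ u` in `ω` and `s ↮ t`, then `s ↔ u`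
already in the restriction of `ω` to the edges touching the component of `u`. -/
lemma conn_restrictK_of_conn {u : V} (hu : u ∉ ({s, t} : Set V)) {ω : Config E}
    (hQ : ¬ Conn ends ω s t) (h : Conn ends ω s u) :
    Conn ends (restrictK ends (comp ends s t u) ω) s u := by
  by_contra hcon
  have hsD : s ∉ cluster ends (restrictK ends (comp ends s t u) ω) u :=
    fun hs => hcon (conn_symm hs)
  have htD : t ∉ cluster ends (restrictK ends (comp ends s t u) ω) u :=
    fun ht => hQ (conn_trans h (conn_mono (restrictK_le _ ω) ht))
  have hDK : cluster ends (restrictK ends (comp ends s t u) ω) u ⊆ comp ends s t u := by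
    intro z hz
    rcases cluster_restrictK_subset hu ω (Or.inl (mem_comp_self u)) hz with hzK | hzst
    · exact hzK
    · rcases mem_pair_iff.1 hzst with rfl | rfl
      · exact absurd hz hsD
      · exact absurd hz htD
  have hclosed : ∀ x ∈ cluster ends (restrictK ends (comp ends s t u) ω) u, ∀ y,
      (openGraph ends ω).Adj x y → y ∈ cluster ends (restrictK ends (comp ends s t u) ω) u := by
    intro x hx y hxy
    obtain ⟨_, e, he, hends⟩ := openGraph_adj.1 hxy
    have heK : restrictK ends (comp ends s t u) ω e = true :=
      restrictK_eq_true_iff.2 ⟨he, mem_touches_of_ends hends (Or.inl (hDK hx))⟩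
    exact conn_trans hx (conn_of_openAdj ⟨e, heK, hends⟩)
  exact hsD (mem_of_conn_of_closed hclosed (mem_cluster_self _ _ _) (conn_symm h))

/-- On `{s ↮ t}`: `s ↔ u` in `ω` iff `s ↔ u` in the restriction to the edges touching the
component of `u`. -/
lemma conn_iff_conn_restrictK {u : V} (hu : u ∉ ({s, t} : Set V)) {ω : Config E}
    (hQ : ¬ Conn ends ω s t) :
    Conn ends ω s u ↔ Conn ends (restrictK ends (comp ends s t u) ω) s u :=
  ⟨conn_restrictK_of_conn hu hQ, fun h => conn_mono (restrictK_le _ ω) h⟩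

/-- The component does not depend on the order of the terminals. -/
lemma comp_comm (u : V) : comp ends t s u = comp ends s t u := by
  unfold comp base
  rw [Set.pair_comm]

/-- On `{s ↮ t}`: `t ↔ u` in `ω` iff `t ↔ u` in the restriction to the edges touching the
component of `u`. -/
lemma conn_t_iff_conn_restrictK {u : V} (hu : u ∉ ({s, t} : Set V)) {ω : Config E}
    (hQ : ¬ Conn ends ω s t) :
    Conn ends ω t u ↔ Conn ends (restrictK ends (comp ends s t u) ω) t u := by
  have hu' : u ∉ ({t, s} : Set V) := by rwa [Set.pair_comm]
  have hQ' : ¬ Conn ends ω t s := fun h => hQ (conn_symm h)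
  rw [← comp_comm]
  exact conn_iff_conn_restrictK hu' hQ'

/-- The cluster of `s` in the restriction to the edges off `K ∪ K′` avoids `K ∪ K′`. -/
lemma cluster_restrict_rest_subset {K K' : Set V} (hsK : s ∉ K ∪ K') (ω : Config E) :
    cluster ends (restrict (touches ends K ∪ touches ends K')ᶜ ω) s ⊆ (K ∪ K')ᶜ := by
  intro z hz
  refine mem_of_conn_of_closed (ends := ends)
    (ω := restrict (touches ends K ∪ touches ends K')ᶜ ω) (S := (K ∪ K')ᶜ) ?_ hsK hz
  intro x _ y hxy
  obtain ⟨_, e, he, hends⟩ := openGraph_adj.1 hxy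
  obtain ⟨-, heR⟩ := restrict_eq_true_iff.1 he
  have hK := not_mem_of_not_mem_touches hends (fun h => heR (Or.inl h))
  have hK' := not_mem_of_not_mem_touches hends (fun h => heR (Or.inr h))
  rintro (hy | hy)
  · exact hK.2 hy
  · exact hK'.2 hy

/-- **Decomposition of `{s ↔ t}` across two components and the rest.** For `u, v` not terminals
with `v ∉ comp u`, write `K = comp u`, `K′ = comp v`, `R = (touches K ∪ touches K′)ᶜ`. If `s ↮ t`
in each of the three restrictions `restrictK K ω`, `restrictK K′ ω`, `restrict R ω`, then `s ↮ t`
in `ω`. (An open `s`–`t` path runs through a single component or through none.) -/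
lemma not_conn_st_of_three {u v : V} (hu : u ∉ ({s, t} : Set V)) (hv : v ∉ ({s, t} : Set V))
    (hvu : v ∉ comp ends s t u) {ω : Config E}
    (h1 : ¬ Conn ends (restrictK ends (comp ends s t u) ω) s t)
    (h2 : ¬ Conn ends (restrictK ends (comp ends s t v) ω) s t)
    (h3 : ¬ Conn ends
      (restrict (touches ends (comp ends s t u) ∪ touches ends (comp ends s t v))ᶜ ω) s t) :
    ¬ Conn ends ω s t := by
  set K := comp ends s t u with hK
  set K' := comp ends s t v with hK'
  set ωK := restrictK ends K ω with hωK
  set ωK' := restrictK ends K' ω with hωK'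
  set ωR := restrict (touches ends K ∪ touches ends K')ᶜ ω with hωR
  set S : Set V := cluster ends ωK s ∪ cluster ends ωK' s ∪ cluster ends ωR s with hS
  have hsK : s ∉ K := fun h => comp_subset hu h (by simp)
  have hsK' : s ∉ K' := fun h => comp_subset hv h (by simp)
  have htK : t ∉ K := fun h => comp_subset hu h (by simp)
  have htK' : t ∉ K' := fun h => comp_subset hv h (by simp)
  have hdisj : Disjoint K K' := comp_disjoint hvu
  have hsub1 : cluster ends ωK s ⊆ K ∪ ({s, t} : Set V) :=
    cluster_restrictK_subset hu ω (Or.inr (by simp))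
  have hsub2 : cluster ends ωK' s ⊆ K' ∪ ({s, t} : Set V) :=
    cluster_restrictK_subset hv ω (Or.inr (by simp))
  have hsub3 : cluster ends ωR s ⊆ (K ∪ K')ᶜ :=
    cluster_restrict_rest_subset (fun h => h.elim hsK hsK') ω
  have htS : t ∉ S := by
    rintro ((ht | ht) | ht)
    · exact h1 ht
    · exact h2 ht
    · exact h3 ht
  have hsS : s ∈ S := Or.inl (Or.inl (mem_cluster_self _ _ _))
  -- `S` is closed under open adjacency in `ω`
  have hclosed : ∀ x ∈ S, ∀ y, (openGraph ends ω).Adj x y → y ∈ S := by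
    intro x hx y hxy
    obtain ⟨_, e, he, hends⟩ := openGraph_adj.1 hxy
    have hxt : x ≠ t := fun h => htS (h ▸ hx)
    -- which of the three groups does `e` belong to?
    by_cases heK : e ∈ touches ends K
    · -- `e` touches `K`
      have heK' : ωK e = true := restrictK_eq_true_iff.2 ⟨he, heK⟩
      have hadj : Conn ends ωK x y := conn_of_openAdj ⟨e, heK', hends⟩
      rcases hx with (hx | hx) | hx
      · exact Or.inl (Or.inl (conn_trans hx hadj))
      · -- `x ∈ cluster ωK' s ⊆ K′ ∪ {s,t}`; show `x = s`
        have hxs : x = s := by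
          rcases hsub2 hx with hxK' | hxst
          · -- `x ∈ K′`: then `y ∈ K` (the edge touches `K`), and `y ∉ {s,t}` puts `x ∈ K` — contradiction
            exfalso
            obtain ⟨a, haK, b, hab⟩ := heK
            rw [hends, Sym2.eq_iff] at hab
            rcases hab with ⟨rfl, rfl⟩ | ⟨rfl, rfl⟩
            · exact Set.disjoint_left.1 hdisj haK hxK'
            · have hyst : y ∉ ({s, t} : Set V) := comp_subset hu haK
              exact Set.disjoint_left.1 hdisj (mem_comp_of_adj' hu haK
                (comp_subset hv hxK') hends) hxK'
          · rcases mem_pair_iff.1 hxst with rfl | rfl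
            · rfl
            · exact absurd rfl hxt
        subst hxs
        exact Or.inl (Or.inl (conn_of_openAdj ⟨e, heK', hends⟩))
      · have hxs : x = s := by
          have hxKK' := hsub3 hx
          obtain ⟨a, haK, b, hab⟩ := heK
          rw [hends, Sym2.eq_iff] at hab
          rcases hab with ⟨rfl, rfl⟩ | ⟨rfl, rfl⟩
          · exact absurd (Or.inl haK) hxKK'
          · by_contra hxs
            have hxst : x ∉ ({s, t} : Set V) := by
              rw [mem_pair_iff]; rintro (h | h)
              · exact hxs h
              · exact hxt h
            exact hxKK' (Or.inl (mem_comp_of_adj' hu haK hxst hends))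
        subst hxs
        exact Or.inl (Or.inl (conn_of_openAdj ⟨e, heK', hends⟩))
    · by_cases heK'' : e ∈ touches ends K'
      · -- `e` touches `K′`
        have heK'o : ωK' e = true := restrictK_eq_true_iff.2 ⟨he, heK''⟩
        have hadj : Conn ends ωK' x y := conn_of_openAdj ⟨e, heK'o, hends⟩
        rcases hx with (hx | hx) | hx
        · have hxs : x = s := by
            rcases hsub1 hx with hxK | hxst
            · exfalso
              obtain ⟨a, haK', b, hab⟩ := heK''
              rw [hends, Sym2.eq_iff] at hab
              rcases hab with ⟨rfl, rfl⟩ | ⟨rfl, rfl⟩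
              · exact Set.disjoint_left.1 hdisj hxK haK'
              · exact Set.disjoint_left.1 hdisj hxK (mem_comp_of_adj' hv haK'
                  (comp_subset hu hxK) hends)
            · rcases mem_pair_iff.1 hxst with rfl | rfl
              · rfl
              · exact absurd rfl hxt
          subst hxs
          exact Or.inl (Or.inr (conn_of_openAdj ⟨e, heK'o, hends⟩))
        · exact Or.inl (Or.inr (conn_trans hx hadj))
        · have hxs : x = s := by
            have hxKK' := hsub3 hx
            obtain ⟨a, haK', b, hab⟩ := heK''
            rw [hends, Sym2.eq_iff] at hab
            rcases hab with ⟨rfl, rfl⟩ | ⟨rfl, rfl⟩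
            · exact absurd (Or.inr haK') hxKK'
            · by_contra hxs
              have hxst : x ∉ ({s, t} : Set V) := by
                rw [mem_pair_iff]; rintro (h | h)
                · exact hxs h
                · exact hxt h
              exact hxKK' (Or.inr (mem_comp_of_adj' hv haK' hxst hends))
          subst hxs
          exact Or.inl (Or.inr (conn_of_openAdj ⟨e, heK'o, hends⟩))
      · -- `e` is a rest edge
        have heR : e ∈ (touches ends K ∪ touches ends K')ᶜ := fun h => h.elim heK heK''
        have heRo : ωR e = true := restrict_eq_true_iff.2 ⟨he, heR⟩
        have hadj : Conn ends ωR x y := conn_of_openAdj ⟨e, heRo, hends⟩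
        have hxnot := not_mem_of_not_mem_touches hends heK
        have hxnot' := not_mem_of_not_mem_touches hends heK''
        rcases hx with (hx | hx) | hx
        · have hxs : x = s := by
            rcases hsub1 hx with hxK | hxst
            · exact absurd hxK hxnot.1
            · rcases mem_pair_iff.1 hxst with rfl | rfl
              · rfl
              · exact absurd rfl hxt
          subst hxs
          exact Or.inr (conn_of_openAdj ⟨e, heRo, hends⟩)
        · have hxs : x = s := by
            rcases hsub2 hx with hxK' | hxst
            · exact absurd hxK' hxnot'.1
            · rcases mem_pair_iff.1 hxst with rfl | rfl
              · rfl
              · exact absurd rfl hxt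
          subst hxs
          exact Or.inr (conn_of_openAdj ⟨e, heRo, hends⟩)
        · exact Or.inr (conn_trans hx hadj)
  intro hst
  exact htS (mem_of_conn_of_closed hclosed hsS hst)

/-- `{s ↔ t}` in `ω` iff `s ↔ t` in one of the three restrictions. -/
lemma conn_st_iff {u v : V} (hu : u ∉ ({s, t} : Set V)) (hv : v ∉ ({s, t} : Set V))
    (hvu : v ∉ comp ends s t u) (ω : Config E) :
    Conn ends ω s t ↔
      Conn ends (restrictK ends (comp ends s t u) ω) s t ∨
      Conn ends (restrictK ends (comp ends s t v) ω) s t ∨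
      Conn ends
        (restrict (touches ends (comp ends s t u) ∪ touches ends (comp ends s t v))ᶜ ω) s t := by
  constructor
  · intro h
    by_contra hcon
    push Not at hcon
    exact not_conn_st_of_three hu hv hvu hcon.1 hcon.2.1 hcon.2.2 h
  · rintro (h | h | h)
    · exact conn_mono (restrictK_le _ ω) h
    · exact conn_mono (restrictK_le _ ω) h
    · exact conn_mono (restrict_le _ ω) h

end Separated

end Summit.Ventures.PercRepro2
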